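import Literature.AlgebraicGeometry.DuqueFrancoVillaflor2025.JoinQuadraticFundamentalForm
import Literature.AlgebraicGeometry.DuqueFrancoVillaflor2025.ZeroDimensionalFakeQuadraticForm
import Literature.AlgebraicGeometry.DuqueFrancoVillaflor2025.SplitHypersurfaceFakeLinearCycles
import Literature.AlgebraicGeometry.HodgeTheory.FermatPolynomialJacobianIdeal
import HarnessLib

/-!
# Example 5.1 of Duque Franco–Villaflor: the quadratic fundamental form of the Hodge locus of the linear cycle
# `ℙ^{n/2} ⊂ X^n_d` vanishes — via Thm. 1.3 (i) ("`q_1`, `q_2` vanish ⟹ `q` vanishes") and the point `Z_0 ⊂ {x_0^d + x_1^d = 0}`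

J. Duque Franco, R. Villaflor Loyola, *Periods of join algebraic cycles*, Ann. Sc. Norm. Super. Pisa (2025) =
arXiv:2312.17222 [DuqueFrancoVillaflor2025Join] (held text `paper:arxiv-2312.17222`; arXiv v1–v3 numbering,
Thm. 1.3 = Thm. 4.1 of v4, §5 unchanged), §5 "Examples in Fermat varieties", verbatim (p. 13):

> **Example 5.1.** … `[Z_0]_prim = (−1/d) res(P_{Z_0}(x_0dx_1 − x_1dx_0)/(x_0^d + x_1^d))` for the associated degree
> `(d−2)` polynomial `P_{Z_0} = dζ_{2d} (x_0^{d−1} − (ζ_{2d}x_1)^{d−1})/(x_0 − ζ_{2d}x_1)`. Consequently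
> `J^{x_0^d+x_1^d,[Z_0]} = ⟨x_0 − ζ_{2d}x_1, x_1^{d−1}⟩` and the quadratic fundamental form `q` vanishes (by
> Remark 2.3 this is reduced to check that `q(x_0 − ζ_{2d}x_1, x_0 − ζ_{2d}x_1) = 0`).
> For higher dimensions, the Fermat polynomial `x_0^d + ⋯ + x_{n+1}^d` can be written as a sum of `n/2+1` Fermat
> polynomials in two variables. Let `X_i = {x_{2i−2}^d + x_{2i−1}^d = 0}`, and `Z_i = {(ζ_{2d} : 1)} ⊆ X_i` for each
> `i = 1, …, n/2+1`, then `ℙ^{n/2} = J(Z_1, …, Z_{n/2+1})`. In consequence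
> `P_{ℙ^{n/2}} = d^{n/2+1}ζ_{2d}^{n/2+1} ∏_{i=1}^{n/2+1} (x_{2i−2}^{d−1} − (ζ_{2d}x_{2i−1})^{d−1})/(x_{2i−2} − ζ_{2d}x_{2i−1})`
> and so `J^{F,[ℙ^{n/2}]} = ⟨x_0 − ζ_{2d}x_1, x_1^{d−1}, …, x_n − ζ_{2d}x_{n+1}, x_{n+1}^{d−1}⟩`. By item (i) of
> Theorem 1.3 its quadratic fundamental form also vanishes. One can do similar computations for all other linear
> cycles in the Fermat variety.

with Theorem 1.3 (i): "If `q_1` and `q_2` vanish in all degrees `ℓ ≤ e`, then `q` vanishes in degree `e`" and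
Remark 2.2: "if `W` is smooth at `x`, then `q_{σ,x}` vanishes" (Thm. 2.1: `q : Sym²(J^{F,λ}) → R^F/⟨P_λ⟩`,
`q(G,H) = Σ_i (H ∂Q_i/∂x_i − R_i ∂G/∂x_i)`, `G·P_λ = Σ Q_i ∂F/∂x_i`, `H·P_λ = Σ R_i ∂F/∂x_i`).

## What this file proves (0 facts, 0 sorry), over any field `K` in which `d ≥ 2` is a unit

Vocabulary of the tree: `macleanForm` (DFV 2023 Thm. 6.1), `joinPoly`, `liftInl/Inr`,
`macleanForm_join_mem_of_generators` (Thm. 1.3 eq. (eqQFFjoin) and (i), file `JoinQuadraticFundamentalForm.lean`),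
`pointForm c = x_0 − cx_1`, `dfvLift`, `dfvNumerator` (DFV's `P` of a point: `P·(x_0 − cx_1) = aF_{x_0} − bF_{x_1}`,
Thm. 7.1), `pointIdeal`, `blockSum`/`blockEquiv`/`pairIndexEquiv` (the `n/2+1` blocks of two variables, file
`SplitHypersurfaceFakeLinearCycles.lean`), `fermatPolynomial K n d = Σ x_i^d`.

* `MacleanFormVanishes F P` — the algebraic content of "`q` vanishes" on `J^{F,λ} = (J^F : P)`: for ALL
  `G, H ∈ (J^F : P)` and ALL lifts, `q(G,H;Q,R) ∈ J^F + ⟨P⟩`;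
* **`macleanFormVanishes_of_generators`** — the reduction to generators in ONE ring ("by Remark 2.3 this is reduced
  to check that `q(L, L) = 0`"): by the `K[x]`-bilinearity of `q` modulo `J^F` and the independence of the lifts
  (tree, given `H_1(∂F) = 0`);
* **`MacleanFormVanishes.join`** — **Theorem 1.3 (i)** in this vocabulary: for forms `f`, `g` of degree `d ≥ 2` with
  Artinian Gorenstein Jacobian ideals, `q_1 ≡ 0` on `(J^f : P_1)` and `q_2 ≡ 0` on `(J^g : P_2)` imply `q ≡ 0` on
  `(J^{f+g} : P_1P_2)`;
* **`MacleanFormVanishes.rename_equiv`** — invariance under relabeling the variables (with `macleanForm_rename_equiv`,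
  `span_pderiv_rename_equiv`; "similar computations for all other linear cycles");
* **`macleanFormVanishes_fermatPolynomial_zero`** — **the point**: for `ζ^d = −1` and DFV's `P` of `(ζ:1)`
  (`= P_{Z_0}/(dζ_{2d})`), `q ≡ 0` on `J^{x_0^d+x_1^d,[Z_0]} = (J : P) = ⟨x_0 − ζx_1, x_1^{d−1}⟩`: `q(L,L) = −d·F(ζ,1) = 0`
  (tree `macleanForm_pointForm_root`), the pairs with `x_1^{d−1} ∈ J^F` by Remark 2.3 and symmetry;
* **`macleanFormVanishes_blockSum_fermatPolynomial`** — induction over the blocks (`blockSum_succ`: `F_0 ⊕ ⋯ ⊕ F_m`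
  is the join of `F_0 ⊕ ⋯ ⊕ F_{m−1}` with `F_m`, relabelled) — and
  **`macleanFormVanishes_fermatPolynomial_linearCycle`** — **Example 5.1 for every even `n = 2k` and every `d ≥ 2`**:
  on `X^n_d = {x_0^d + ⋯ + x_{n+1}^d = 0}` (`rename_pairIndexEquiv_blockSum_fermatPolynomial`), for the linear cycle
  `{x_{2j} = ζ_jx_{2j+1}}` (`ζ_j^d = −1`; the printed cycle has all `ζ_j = ζ_{2d}`) and `P = ∏_j P_j(x_{2j},x_{2j+1})`
  (`= P_{ℙ^{n/2}}` up to a unit), `q ≡ 0` on `J^{F,[ℙ^{n/2}]} = (J^F : P)` modulo `J^F + ⟨P⟩`, all pairs, all lifts.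

NOT formalised (cited): that `q` IS the quadratic fundamental form of `V_{[ℙ^{n/2}]}` (Maclean, Thm. 2.1) and the
residue formula for `P_{Z_0}`; the other pairings `b` of Example 5.1's last sentence differ from the consecutive one
by a relabeling (`MacleanFormVanishes.rename_equiv`).

HONEST FRAMING (cell pub-hlocus): certified instances and evidence bearing on the general Hodge conjecture;
no claim.

## References

* [DuqueFrancoVillaflor2025Join] J. Duque Franco, R. Villaflor Loyola, *Periods of join algebraic cycles*,
  arXiv:2312.17222, Example 5.1, Theorem 1.3 (i) (= Theorem 4.1 (i) of arXiv v4), Theorem 2.1, Remarks 2.2–2.3,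
  Theorem 7.1.
* [Villaflorloyola2021] R. Villaflor Loyola, *Periods of complete intersection algebraic cycles*, manuscripta
  math. 167 (2022), Prop. 4.1 (relabeling of variables).
-/

noncomputable section

namespace Literature.AlgebraicGeometry.DuqueFrancoVillaflor2025

open MvPolynomial Finset RingTheory.Sequence
open Literature.RingTheory.Koszul Literature.RingTheory.MvPolynomial
open Literature.AlgebraicGeometry.HodgeTheory
open Literature.AlgebraicGeometry.Motives Literature.AlgebraicGeometry.Motives.UniversalHypersurface
open Literature.AlgebraicGeometry.DuqueFrancoVillaflor2023 (macleanForm)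

universe u v w

variable {K : Type u} [Field K]

/-! ## §1. "`q` vanishes" on `J^{F,λ} = (J^F : P_λ)` -/

section Vanishes

variable {σ : Type v} [Fintype σ]

/-- **"The quadratic fundamental form `q` vanishes"** (on `J^{F,λ} = (J^F : P_λ)`, Thm. 2.1 / Thm. 1.3; Rem. 2.2:
"if `W` is smooth at `x`, then `q_{σ,x}` vanishes"), algebraically: for all `G, H ∈ (J^F : P)` and ALL lifts
`G·P = Σ_v Q_v ∂_vF`, `H·P = Σ_v R_v ∂_vF`, Maclean's `q(G,H;Q,R) = Σ_v (H ∂_vQ_v − R_v ∂_vG)` lies in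
`J^F + ⟨P⟩` (i.e. is `0 ∈ R^F/⟨P_λ⟩`). [cite: DuqueFrancoVillaflor2025Join, Theorem 1.3 (i) and Remark 2.2 (= Theorem 4.1 (i) of arXiv v4)] -/
def MacleanFormVanishes (F P : MvPolynomial σ K) : Prop :=
  ∀ ⦃G H : MvPolynomial σ K⦄, G ∈ (Ideal.span (Set.range fun v => pderiv v F)).colon {P} →
    H ∈ (Ideal.span (Set.range fun v => pderiv v F)).colon {P} →
    ∀ ⦃Q R : σ → MvPolynomial σ K⦄, G * P = ∑ v, Q v * pderiv v F → H * P = ∑ v, R v * pderiv v F →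
      macleanForm G H Q R ∈ Ideal.span (Set.range fun v => pderiv v F) ⊔ Ideal.span {P}

/-- Elements of `(J^F : P)` have lifts: `G·P = Σ_v Q_v ∂_vF` for some `Q`. [cite: DuqueFrancoVillaflor2025Join, Theorem 2.1 (Maclean)] -/
theorem exists_lift_of_mem_colon {F P G : MvPolynomial σ K}
    (hG : G ∈ (Ideal.span (Set.range fun v => pderiv v F)).colon {P}) :
    ∃ Q : σ → MvPolynomial σ K, G * P = ∑ v, Q v * pderiv v F := by
  rw [Submodule.mem_colon_singleton, smul_eq_mul] at hG
  obtain ⟨Q, hQ⟩ := Ideal.mem_span_range_iff_exists_fun.mp hG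
  exact ⟨Q, hQ.symm⟩

/-- **Reduction to generators in one ring** ("by (rmkqffjac) this is reduced to check that
`q(x_0 − ζ_{2d}x_1, x_0 − ζ_{2d}x_1) = 0`", Example 5.1): if the partials of `F` have only trivial syzygies,
`𝒢` generates `(J^F : P)` and `q(a,b) ∈ J^F + ⟨P⟩` for all `a, b ∈ 𝒢` (all lifts), then `q` vanishes on all of
`(J^F : P)` — by `K[x]`-bilinearity mod `J^F` (`macleanForm_mul_mul_sub_mem`) and independence of the lifts.
[cite: DuqueFrancoVillaflor2025Join, Example 5.1 and Remark 2.3] -/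
theorem macleanFormVanishes_of_generators {F P : MvPolynomial σ K} (hK : HasKoszulSyzygies fun v => pderiv v F)
    {𝒢 : Set (MvPolynomial σ K)} (h𝒢 : Ideal.span 𝒢 = (Ideal.span (Set.range fun v => pderiv v F)).colon {P})
    (hq : ∀ a ∈ 𝒢, ∀ b ∈ 𝒢, ∀ Q S : σ → MvPolynomial σ K,
      a * P = ∑ v, Q v * pderiv v F → b * P = ∑ v, S v * pderiv v F →
        macleanForm a b Q S ∈ Ideal.span (Set.range fun v => pderiv v F) ⊔ Ideal.span {P}) :
    MacleanFormVanishes F P := by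
  classical
  intro G H hG hH Q R hQ hR
  set J := Ideal.span (Set.range fun v => pderiv v F) with hJdef
  have hl : ∀ a ∈ 𝒢, ∃ Qa : σ → MvPolynomial σ K, a * P = ∑ v, Qa v * pderiv v F := fun a ha =>
    exists_lift_of_mem_colon (by rw [← h𝒢]; exact Ideal.subset_span ha)
  rw [← h𝒢] at hG hH
  obtain ⟨n, A, x, hx⟩ := Submodule.mem_span_set'.mp hG
  obtain ⟨m, B, y, hy⟩ := Submodule.mem_span_set'.mp hH
  choose Qx hQx using fun k => hl (x k : MvPolynomial σ K) (x k).2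
  choose Sy hSy using fun l => hl (y l : MvPolynomial σ K) (y l).2
  simp only [smul_eq_mul] at hx hy
  -- the induced lifts
  set Q₀ : σ → MvPolynomial σ K := ∑ k, fun v => A k * Qx k v with hQ₀
  set R₀ : σ → MvPolynomial σ K := ∑ l, fun v => B l * Sy l v with hR₀
  have hQ₀' : G * P = ∑ v, Q₀ v * pderiv v F := by
    rw [← hx, hQ₀]
    exact sum_mul_eq_sum_sum_lift Finset.univ fun k _ => mul_mul_eq_sum_mul_lift (hQx k) (A k)
  have hR₀' : H * P = ∑ v, R₀ v * pderiv v F := by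
    rw [← hy, hR₀]
    exact sum_mul_eq_sum_sum_lift Finset.univ fun l _ => mul_mul_eq_sum_mul_lift (hSy l) (B l)
  have hindep := macleanForm_sub_macleanForm_mem_of_lifts' hK hQ hQ₀' hR hR₀'
  have hmain : macleanForm G H Q₀ R₀ ∈ J ⊔ Ideal.span {P} := by
    rw [← hx, ← hy, hQ₀, hR₀, macleanForm_sum_left]
    refine Ideal.sum_mem _ fun k _ => ?_
    rw [macleanForm_sum_right]
    refine Ideal.sum_mem _ fun l _ => ?_
    have h1 := macleanForm_mul_mul_sub_mem hK (hQx k) (hSy l) (A k) (B l)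
    have h2 : A k * B l * macleanForm (x k : MvPolynomial σ K) (y l) (Qx k) (Sy l) ∈ J ⊔ Ideal.span {P} :=
      Ideal.mul_mem_left _ _ (hq _ (x k).2 _ (y l).2 _ _ (hQx k) (hSy l))
    have e := sub_add_cancel
      (macleanForm (A k * (x k : MvPolynomial σ K)) (B l * (y l : MvPolynomial σ K)) (fun v => A k * Qx k v)
        fun v => B l * Sy l v)
      (A k * B l * macleanForm (x k : MvPolynomial σ K) (y l) (Qx k) (Sy l))
    rw [← e]
    exact Ideal.add_mem _ (Ideal.mem_sup_left h1) h2
  have e := sub_add_cancel (macleanForm G H Q R) (macleanForm G H Q₀ R₀)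
  rw [← e]
  exact Ideal.add_mem _ (Ideal.mem_sup_left hindep) hmain

end Vanishes

/-! ## §2. Theorem 1.3 (i) as a statement about `MacleanFormVanishes` -/

section JoinVanishes

variable {σ : Type v} {τ : Type w} [Fintype σ] [Fintype τ] {f : MvPolynomial σ K} {g : MvPolynomial τ K}

/-- **Theorem 1.3 (i) [= Thm. 4.1 (i) of arXiv v4]: "If `q_1` and `q_2` vanish … then `q` vanishes"** — for forms
`f`, `g` of degree `d ≥ 2` with Artinian Gorenstein Jacobian ideals, if `q_1` vanishes on `J^{f,[Z_1]} = (J^f : P_{Z_1})`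
and `q_2` on `J^{g,[Z_2]} = (J^g : P_{Z_2})`, then `q` vanishes on
`J^{f+g,[J(Z_1,Z_2)]} = (J^{f+g} : P_{Z_1}P_{Z_2})` (all lifts).
[cite: DuqueFrancoVillaflor2025Join, Theorem 1.3 (i) (= Theorem 4.1 (i) of arXiv v4)] -/
theorem MacleanFormVanishes.join {d s₁ s₂ : ℕ} (hf : f.IsHomogeneous d) (hg : g.IsHomogeneous d) (hd : 2 ≤ d)
    (hJf : IsArtinianGorenstein (Ideal.span (Set.range fun i => pderiv i f)) s₁)
    (hJg : IsArtinianGorenstein (Ideal.span (Set.range fun j => pderiv j g)) s₂)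
    {P₁ : MvPolynomial σ K} {P₂ : MvPolynomial τ K}
    (h₁ : MacleanFormVanishes f P₁) (h₂ : MacleanFormVanishes g P₂) :
    MacleanFormVanishes (joinPoly f g) (rename Sum.inl P₁ * rename Sum.inr P₂) := by
  intro G H hG hH 𝒬 ℛ h𝒬 hℛ
  exact macleanForm_join_mem_of_generators hf hg hd hJf hJg
    (𝒢₁ := ((Ideal.span (Set.range fun i => pderiv i f)).colon {P₁} : Set (MvPolynomial σ K)))
    (𝒢₂ := ((Ideal.span (Set.range fun j => pderiv j g)).colon {P₂} : Set (MvPolynomial τ K)))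
    (Ideal.span_eq _) (Ideal.span_eq _)
    (fun a ha b hb Q S hQ hS => h₁ ha hb hQ hS) (fun a ha b hb R T hR hT => h₂ ha hb hR hT) hG hH h𝒬 hℛ

end JoinVanishes

/-! ## §3. Transport along a relabeling of the variables -/

section Transport

variable {σ : Type v} {σ' : Type w} [Fintype σ] [Fintype σ']

omit [Fintype σ] [Fintype σ'] in
/-- Membership in the relabelled ideal: `q ∈ I.map (rename θ) ↔ rename θ⁻¹ q ∈ I`. [folklore] -/
private theorem mem_map_rename_equiv_iff' (θ : σ ≃ σ') (I : Ideal (MvPolynomial σ K)) (q : MvPolynomial σ' K) :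
    q ∈ I.map (rename θ : MvPolynomial σ K →ₐ[K] MvPolynomial σ' K) ↔ rename θ.symm q ∈ I := by
  constructor
  · intro hq
    have h : I.map (rename θ : MvPolynomial σ K →ₐ[K] MvPolynomial σ' K) ≤
        I.comap (rename θ.symm : MvPolynomial σ' K →ₐ[K] MvPolynomial σ K) := by
      refine Ideal.map_le_iff_le_comap.mpr fun g hg => ?_
      rw [Ideal.mem_comap, Ideal.mem_comap, rename_rename, Equiv.symm_comp_self, rename_id, AlgHom.id_apply]
      exact hg
    exact (Ideal.mem_comap.mp (h hq))
  · intro hq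
    have h : rename θ (rename θ.symm q) = q := by
      rw [rename_rename, Equiv.self_comp_symm, rename_id, AlgHom.id_apply]
    rw [← h]
    exact Ideal.mem_map_of_mem _ hq

omit [Fintype σ] [Fintype σ'] in
/-- **`J^{F∘θ⁻¹} = θ(J^F)`**: the Jacobian ideal of a relabelled form is the relabelled Jacobian ideal.
[cite: Villaflorloyola2021, Proposition 4.1 ("after relabeling the variables")] -/
theorem span_pderiv_rename_equiv (θ : σ ≃ σ') (F : MvPolynomial σ K) :
    Ideal.span (Set.range fun w => pderiv w (rename θ F)) =
      (Ideal.span (Set.range fun v => pderiv v F)).map (rename θ : MvPolynomial σ K →ₐ[K] MvPolynomial σ' K) := by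
  rw [Ideal.map_span, ← Set.range_comp]
  congr 1
  ext q
  simp only [Set.mem_range, Function.comp_apply]
  constructor
  · rintro ⟨w, rfl⟩
    refine ⟨θ.symm w, ?_⟩
    conv_rhs => rw [← θ.apply_symm_apply w]
    rw [pderiv_rename θ.injective]
  · rintro ⟨v, rfl⟩
    exact ⟨θ v, by rw [pderiv_rename θ.injective]⟩

/-- **Maclean's expression is equivariant under relabeling**: with the relabelled lifts
`Q'_w = θ(Q_{θ⁻¹w})`, `q(θG, θH; Q', R') = θ(q(G,H;Q,R))`. [cite: DuqueFrancoVillaflor2025Join, Theorem 2.1 (Maclean), eq. (eqQFF)] -/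
theorem macleanForm_rename_equiv (θ : σ ≃ σ') (G H : MvPolynomial σ K) (Q R : σ → MvPolynomial σ K) :
    macleanForm (rename θ G) (rename θ H) (fun w => rename θ (Q (θ.symm w))) (fun w => rename θ (R (θ.symm w))) =
      rename θ (macleanForm G H Q R) := by
  unfold macleanForm
  rw [map_sum, ← θ.sum_comp]
  refine Finset.sum_congr rfl fun v _ => ?_
  simp only [Equiv.symm_apply_apply, pderiv_rename θ.injective, map_sub, map_mul]

/-- Relabelled lifts are lifts: `G·P = Σ_v Q_v ∂_vF` gives `θG·θP = Σ_w θ(Q_{θ⁻¹w}) ∂_w(θF)`.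
[cite: DuqueFrancoVillaflor2025Join, Theorem 2.1 (Maclean)] -/
theorem rename_mul_eq_sum_of_lift (θ : σ ≃ σ') {F G P : MvPolynomial σ K} {Q : σ → MvPolynomial σ K}
    (hQ : G * P = ∑ v, Q v * pderiv v F) :
    rename θ G * rename θ P = ∑ w, rename θ (Q (θ.symm w)) * pderiv w (rename θ F) := by
  rw [← map_mul, hQ, map_sum, ← θ.sum_comp]
  refine Finset.sum_congr rfl fun v _ => ?_
  rw [map_mul, Equiv.symm_apply_apply, pderiv_rename θ.injective]

/-- **"`q` vanishes" is invariant under relabeling the variables.**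
[cite: DuqueFrancoVillaflor2025Join, Theorem 1.3 (i) and Example 5.1 ("similar computations for all other linear cycles")] -/
theorem MacleanFormVanishes.rename_equiv (θ : σ ≃ σ') {F P : MvPolynomial σ K} (h : MacleanFormVanishes F P) :
    MacleanFormVanishes (rename θ F) (rename θ P) := by
  intro G' H' hG' hH' Q' R' hQ' hR'
  have hJ := span_pderiv_rename_equiv θ F
  -- pull everything back along θ
  set G := rename θ.symm G' with hGdef
  set H := rename θ.symm H' with hHdef
  have hGG : rename θ G = G' := by
    rw [hGdef, rename_rename, Equiv.self_comp_symm, rename_id, AlgHom.id_apply]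
  have hHH : rename θ H = H' := by
    rw [hHdef, rename_rename, Equiv.self_comp_symm, rename_id, AlgHom.id_apply]
  have hcol : ∀ {X' : MvPolynomial σ' K},
      X' ∈ (Ideal.span (Set.range fun w => pderiv w (rename θ F))).colon {rename θ P} →
        rename θ.symm X' ∈ (Ideal.span (Set.range fun v => pderiv v F)).colon {P} := by
    intro X' hX'
    rw [hJ, colon_map_rename_equiv, mem_map_rename_equiv_iff'] at hX'
    exact hX'
  have hG : G ∈ (Ideal.span (Set.range fun v => pderiv v F)).colon {P} := hcol hG'
  have hH : H ∈ (Ideal.span (Set.range fun v => pderiv v F)).colon {P} := hcol hH'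
  -- pulled-back lifts
  set Q : σ → MvPolynomial σ K := fun v => rename θ.symm (Q' (θ v)) with hQdef
  set R : σ → MvPolynomial σ K := fun v => rename θ.symm (R' (θ v)) with hRdef
  have hlift : ∀ {X' : MvPolynomial σ' K} {L' : σ' → MvPolynomial σ' K},
      X' * rename θ P = ∑ w, L' w * pderiv w (rename θ F) →
        rename θ.symm X' * P = ∑ v, rename θ.symm (L' (θ v)) * pderiv v F := by
    intro X' L' hL'
    have h := congrArg (rename θ.symm : MvPolynomial σ' K →ₐ[K] MvPolynomial σ K) hL'
    rw [map_mul, rename_rename, Equiv.symm_comp_self, rename_id, AlgHom.id_apply, map_sum] at h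
    rw [h, ← θ.sum_comp]
    refine Finset.sum_congr rfl fun v _ => ?_
    rw [map_mul]
    congr 1
    have := pderiv_rename θ.symm.injective (θ v) (rename θ F)
    rw [rename_rename, Equiv.symm_comp_self, rename_id, AlgHom.id_apply, Equiv.symm_apply_apply] at this
    exact this.symm
  have hQ : G * P = ∑ v, Q v * pderiv v F := hlift hQ'
  have hR : H * P = ∑ v, R v * pderiv v F := hlift hR'
  have hmem := h hG hH hQ hR
  -- push forward
  have hQ'eq : (fun w => rename θ (Q (θ.symm w))) = Q' := by
    funext w
    simp only [hQdef, Equiv.apply_symm_apply, rename_rename, Equiv.self_comp_symm, rename_id, AlgHom.id_apply]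
  have hR'eq : (fun w => rename θ (R (θ.symm w))) = R' := by
    funext w
    simp only [hRdef, Equiv.apply_symm_apply, rename_rename, Equiv.self_comp_symm, rename_id, AlgHom.id_apply]
  have hpush := Ideal.mem_map_of_mem (rename θ : MvPolynomial σ K →ₐ[K] MvPolynomial σ' K) hmem
  rw [Ideal.map_sup, ← hJ, Ideal.map_span, Set.image_singleton, ← macleanForm_rename_equiv, hGG, hHH, hQ'eq,
    hR'eq] at hpush
  exact hpush

end Transport

/-! ## §4. Example 5.1, base: the point `Z_0 = (ζ : 1)` of `X_0 = {x_0^d + x_1^d = 0}`, `ζ^d = −1` -/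

section FermatPoint

variable {e : ℕ}

/-- `x_0^d + x_1^d`, the Fermat binary form (tree `fermatPolynomial K 0 d`). [cite: DuqueFrancoVillaflor2025Join, Example 5.1] -/
theorem fermatPolynomial_zero_eq (d : ℕ) :
    fermatPolynomial K 0 d = (X 0 : MvPolynomial (Fin 2) K) ^ d + X 1 ^ d := by
  show (∑ i : Fin 2, (X i : MvPolynomial (Fin 2) K) ^ d) = _
  rw [Fin.sum_univ_two]

/-- `x_0^d + x_1^d` evaluated at `(ζ : 1)` is `ζ^d + 1`. [cite: DuqueFrancoVillaflor2025Join, Example 5.1] -/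
theorem eval_point_fermatPolynomial_zero (d : ℕ) (ζ : K) :
    eval ![ζ, 1] (fermatPolynomial K 0 d) = ζ ^ d + 1 := by
  rw [fermatPolynomial_zero_eq]
  simp

/-- `∂(x_0^d + x_1^d)/∂x_0 = d·x_0^{d−1}`. [cite: DuqueFrancoVillaflor2025Join, Example 5.1] -/
theorem pderiv_zero_fermatPolynomial_zero (e : ℕ) :
    pderiv 0 (fermatPolynomial K 0 (e + 1)) = C (((e + 1 : ℕ) : K)) * X 0 ^ e := by
  rw [fermatPolynomial_zero_eq, map_add, pderiv_pow, pderiv_pow, pderiv_X_self,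
    pderiv_X_of_ne (by decide : (1 : Fin 2) ≠ 0), mul_zero, add_zero, mul_one, Nat.add_sub_cancel, map_natCast]

/-- `∂(x_0^d + x_1^d)/∂x_1 = d·x_1^{d−1}`. [cite: DuqueFrancoVillaflor2025Join, Example 5.1] -/
theorem pderiv_one_fermatPolynomial_zero (e : ℕ) :
    pderiv 1 (fermatPolynomial K 0 (e + 1)) = C (((e + 1 : ℕ) : K)) * X 1 ^ e := by
  rw [fermatPolynomial_zero_eq, map_add, pderiv_pow, pderiv_pow, pderiv_X_self,
    pderiv_X_of_ne (by decide : (0 : Fin 2) ≠ 1), mul_zero, mul_one, Nat.add_sub_cancel, map_natCast]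
  exact zero_add _

/-- `∂(x_0^d + x_1^d)/∂x_1` does not vanish at `(ζ : 1)` when `d ≠ 0` in `K`. [cite: DuqueFrancoVillaflor2025Join, Example 5.1] -/
theorem eval_point_pderiv_one_fermatPolynomial_zero (hdK : ((e + 1 : ℕ) : K) ≠ 0) (ζ : K) :
    eval ![ζ, 1] (pderiv 1 (fermatPolynomial K 0 (e + 1))) ≠ 0 := by
  rw [pderiv_one_fermatPolynomial_zero]
  simpa using hdK

/-- `x_i^{d−1} ∈ J^{x_0^d + x_1^d}` (`= ⟨x_0^{d−1}, x_1^{d−1}⟩`, `d` a unit). [cite: DuqueFrancoVillaflor2025Join, Example 5.1 ("`J^{x_0^d+x_1^d,[Z_0]} = ⟨x_0 − ζ_{2d}x_1, x_1^{d−1}⟩`")] -/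
theorem X_pow_mem_jacobianIdeal_fermatPolynomial_zero (hdK : ((e + 1 : ℕ) : K) ≠ 0) (i : Fin 2) :
    (X i : MvPolynomial (Fin 2) K) ^ e ∈ jacobianIdeal (fermatPolynomial K 0 (e + 1)) := by
  rw [jacobianIdeal_fermatPolynomial K 0 e (isUnit_iff_ne_zero.mpr hdK)]
  exact Ideal.subset_span ⟨i, rfl⟩

/-- DFV's numerator `aF_{x_0} − bF_{x_1}` for `x_0^d + x_1^d` at `(ζ:1)` (`= d²(x_0^{d−1} − ζ^{d−1}x_1^{d−1})`) is
non-zero for `d ≥ 2` a unit: its value at `(1 : 0)` is `d² ≠ 0`.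
[cite: DuqueFrancoVillaflor2025Join, Example 5.1, Theorem 7.1 eq. (eqPfake0dim)] -/
theorem dfvNumerator_fermatPolynomial_zero_ne_zero (he : 1 ≤ e) (hdK : ((e + 1 : ℕ) : K) ≠ 0) (ζ : K) :
    dfvNumerator (fermatPolynomial K 0 (e + 1)) ζ ≠ 0 := by
  intro h0
  have h := congrArg (eval ![(1 : K), 0]) h0
  rw [dfvNumerator, pderiv_one_fermatPolynomial_zero, pderiv_zero_fermatPolynomial_zero, map_zero] at h
  simp only [map_sub, map_mul, eval_C, map_natCast, map_pow, eval_X, Matrix.cons_val_zero, Matrix.cons_val_one,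
    Matrix.cons_val_fin_one, one_pow, mul_one, zero_pow (by omega : e ≠ 0), mul_zero, sub_zero] at h
  exact hdK (by simpa using h)

/-- **Example 5.1, the point `Z_0 = (ζ:1) ∈ X_0 = {x_0^d + x_1^d = 0}` (`ζ^d = −1`): the quadratic fundamental form
of `V_{[Z_0]}` vanishes** — "`J^{x_0^d+x_1^d,[Z_0]} = ⟨x_0 − ζ_{2d}x_1, x_1^{d−1}⟩` and the quadratic fundamental
form `q` vanishes (by Remark 2.3 this is reduced to check that `q(x_0 − ζ_{2d}x_1, x_0 − ζ_{2d}x_1) = 0`)". Here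
`d = e + 1 ≥ 2` is non-zero in `K`, `P` is DFV's polynomial with `P·(x_0 − ζx_1) = aF_{x_0} − bF_{x_1}`
(`= P_{Z_0}` up to the unit `dζ_{2d}`, Thm. 7.1), `(J^F : P) = ⟨x_0 − ζx_1, x_1^{d−1}⟩` (tree
`jacobianIdeal_colon_eq_pointIdeal`), `q(L,L) = −d·F(ζ,1) = 0` (tree `macleanForm_pointForm_root`), and the
pairs involving `x_1^{d−1} ∈ J^F` vanish by Remark 2.3 and symmetry.
[cite: DuqueFrancoVillaflor2025Join, Example 5.1] -/
theorem macleanFormVanishes_fermatPolynomial_zero (he : 1 ≤ e) (hdK : ((e + 1 : ℕ) : K) ≠ 0) {ζ : K}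
    (hζ : ζ ^ (e + 1) = -1) {P : MvPolynomial (Fin 2) K} (hPh : P.IsHomogeneous (e + 1 - 2))
    (hP : P * pointForm ζ = dfvNumerator (fermatPolynomial K 0 (e + 1)) ζ) :
    MacleanFormVanishes (fermatPolynomial K 0 (e + 1)) P := by
  classical
  set F : MvPolynomial (Fin 2) K := fermatPolynomial K 0 (e + 1) with hFdef
  have hF : F.IsHomogeneous (e + 1) := isHomogeneous_fermatPolynomial 0 (e + 1)
  have hd : 2 ≤ e + 1 := by omega
  have hJ : IsArtinianGorenstein (jacobianIdeal F) (2 * (e + 1 - 2)) := by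
    have h := isArtinianGorenstein_jacobianIdeal_fermatPolynomial (K := K) (n := 0) he hdK
    have h2 : (0 + 2) * (e - 1) = 2 * (e + 1 - 2) := by omega
    rw [h2] at h
    exact h
  have hK : HasKoszulSyzygies fun v => pderiv v F := hasKoszulSyzygies_pderiv_of_isArtinianGorenstein hF hd hJ
  have hP0 : P ≠ 0 := by
    intro h0
    rw [h0, zero_mul] at hP
    exact dfvNumerator_fermatPolynomial_zero_ne_zero he hdK ζ hP.symm
  have hPJ : P * pointForm ζ ∈ jacobianIdeal F := by
    rw [hP]
    exact dfvNumerator_mem_jacobianIdeal F ζ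
  have hcolon : (jacobianIdeal F).colon {P} = pointIdeal (e + 1) ζ :=
    jacobianIdeal_colon_eq_pointIdeal hd hF hJ (Or.inr (eval_point_pderiv_one_fermatPolynomial_zero hdK ζ)) hPh
      hP0 hPJ
  -- the lift of `L = x_0 − ζ x_1` and `q(L, L) = 0`
  have hL : pointForm ζ * P = ∑ i, dfvLift F ζ i * pderiv i F := pointForm_mul_eq_sum_dfvLift hP
  have hroot : eval ![ζ, 1] F = 0 := by
    rw [hFdef, eval_point_fermatPolynomial_zero, hζ, neg_add_cancel]
  have hLL : macleanForm (pointForm ζ) (pointForm ζ) (dfvLift F ζ) (dfvLift F ζ) = 0 :=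
    macleanForm_pointForm_root hF hroot
  have hX1 : (X 1 : MvPolynomial (Fin 2) K) ^ (e + 1 - 1) ∈ jacobianIdeal F := by
    rw [Nat.add_sub_cancel]
    exact X_pow_mem_jacobianIdeal_fermatPolynomial_zero hdK 1
  have hgen0 : pointIdealGens (e + 1) ζ 0 = pointForm ζ := rfl
  have hgen1 : pointIdealGens (e + 1) ζ 1 = X 1 ^ (e + 1 - 1) := rfl
  refine macleanFormVanishes_of_generators hK (𝒢 := Set.range (pointIdealGens (e + 1) ζ)) hcolon.symm ?_
  rintro a ⟨i, rfl⟩ b ⟨j, rfl⟩ Q S hQ hS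
  fin_cases i <;> fin_cases j
  all_goals simp only [Fin.zero_eta, Fin.mk_one, hgen0, hgen1] at hQ hS ⊢
  · -- `q(L, L) ≡ q(L, L; DFV's lifts) = 0`
    have h1 := macleanForm_sub_macleanForm_mem_of_lifts' hK hQ hL hS hL
    rw [hLL, sub_zero] at h1
    exact Ideal.mem_sup_left h1
  · -- `q(L, x_1^{d-1})`: Remark 2.3
    exact macleanForm_mem_of_mem_span_pderiv hK hX1 hS
  · -- `q(x_1^{d-1}, L) ≡ q(L, x_1^{d-1})`: symmetry and Remark 2.3
    have h1 := macleanForm_sub_macleanForm_swap_mem hK hQ hS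
    have h2 := macleanForm_mem_of_mem_span_pderiv (G := pointForm ζ) (Q := S) hK hX1 hQ
    have e := sub_add_cancel (macleanForm ((X 1 : MvPolynomial (Fin 2) K) ^ (e + 1 - 1)) (pointForm ζ) Q S)
      (macleanForm (pointForm ζ) ((X 1 : MvPolynomial (Fin 2) K) ^ (e + 1 - 1)) S Q)
    rw [← e]
    exact Ideal.add_mem _ (Ideal.mem_sup_left h1) h2
  · -- `q(x_1^{d-1}, x_1^{d-1})`: Remark 2.3
    exact macleanForm_mem_of_mem_span_pderiv hK hX1 hS

end FermatPoint

/-! ## §5. Example 5.1 for `X^n_d`: `ℙ^{n/2} = J(Z_1, …, Z_{n/2+1})`, induction over the blocks -/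

section FermatBlocks

variable {e m : ℕ}

/-- `J^{x_0^d+x_1^d}` is Artinian Gorenstein of socle `2(d−2)` (`d = e+1 ≥ 2` a unit in `K`).
[cite: DuqueFrancoVillaflor2025Join, Definition 2.2 and Example 5.1] -/
theorem isArtinianGorenstein_jacobianIdeal_fermatPolynomial_zero (he : 1 ≤ e) (hdK : ((e + 1 : ℕ) : K) ≠ 0) :
    IsArtinianGorenstein (jacobianIdeal (fermatPolynomial K 0 (e + 1))) (2 * (e + 1 - 2)) := by
  have h := isArtinianGorenstein_jacobianIdeal_fermatPolynomial (K := K) (n := 0) he hdK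
  have h2 : (0 + 2) * (e - 1) = 2 * (e + 1 - 2) := by omega
  rw [h2] at h
  exact h

omit [Field K] in
/-- `blockEquiv` on the first `m` blocks. [folklore] -/
private theorem blockEquiv_inl' {β : Type*} (j : Fin m) (b : β) :
    blockEquiv m β (Sum.inl (j, b)) = (Fin.castSucc j, b) := rfl

omit [Field K] in
/-- `blockEquiv` on the new block. [folklore] -/
private theorem blockEquiv_inr' {β : Type*} (b : β) : blockEquiv m β (Sum.inr b) = (Fin.last m, b) := rfl

/-- `rename blockEquiv (rename inl (rename (j,·) p)) = rename (castSucc j, ·) p`. [folklore] -/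
private theorem rename_blockEquiv_rename_inl' (j : Fin m) (p : MvPolynomial (Fin 2) K) :
    rename (blockEquiv m (Fin 2)) (rename (Sum.inl : Fin m × Fin 2 → (Fin m × Fin 2) ⊕ Fin 2)
        (rename (Prod.mk j) p)) = rename (R := K) (Prod.mk (Fin.castSucc j)) p := by
  rw [rename_rename, rename_rename]
  exact congrArg (fun φ : Fin 2 → Fin (m + 1) × Fin 2 => rename φ p) (funext fun i => blockEquiv_inl' j i)

/-- `rename blockEquiv (rename inr p) = rename (last m, ·) p`. [folklore] -/
private theorem rename_blockEquiv_rename_inr' (p : MvPolynomial (Fin 2) K) :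
    rename (blockEquiv m (Fin 2)) (rename (Sum.inr : Fin 2 → (Fin m × Fin 2) ⊕ Fin 2) p) =
      rename (R := K) (Prod.mk (Fin.last m)) p := by
  rw [rename_rename]
  exact congrArg (fun φ : Fin 2 → Fin (m + 1) × Fin 2 => rename φ p) (funext fun i => blockEquiv_inr' i)

/-- **Recursion of the sum of blocks**: `F_0 ⊕ ⋯ ⊕ F_m` is the join `(F_0 ⊕ ⋯ ⊕ F_{m−1}) + F_m`, relabelled along
`blockEquiv` ("`x_0^d + ⋯ + x_{n+1}^d` can be written as a sum of `n/2+1` Fermat polynomials in two variables").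
[cite: DuqueFrancoVillaflor2025Join, Example 5.1 and Theorem 1.1] -/
theorem blockSum_succ (F : Fin (m + 1) → MvPolynomial (Fin 2) K) :
    blockSum F = rename (blockEquiv m (Fin 2))
      (joinPoly (blockSum fun j : Fin m => F (Fin.castSucc j)) (F (Fin.last m))) := by
  rw [blockSum, Fin.sum_univ_castSucc, joinPoly, map_add, blockSum, map_sum, map_sum, rename_blockEquiv_rename_inr']
  congr 1
  exact Finset.sum_congr rfl fun j _ => (rename_blockEquiv_rename_inl' j _).symm

/-- No variables: Maclean's expression over an empty set of variables is `0`. [folklore] -/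
private theorem macleanForm_eq_zero_of_isEmpty {ι : Type*} [Fintype ι] [IsEmpty ι] (G H : MvPolynomial ι K)
    (Q R : ι → MvPolynomial ι K) : macleanForm G H Q R = 0 := by
  unfold macleanForm
  simp

/-- **Example 5.1 for all even `n`, block form**: on `X = {Σ_{j<m} (x_{(j,0)}^d + x_{(j,1)}^d) = 0}` (the Fermat
variety `X^{2m−2}_d` in block coordinates), for `ℙ^{m−1} = J(Z_1, …, Z_m)` with `Z_j = (ζ_j : 1)`, `ζ_j^d = −1`, and
`P = ∏_j P_j(x_{(j,·)})` (`P_j` DFV's polynomial of `Z_j`, so `P = P_{ℙ^{n/2}}` up to a unit by Thm. 1.1),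
**`q` vanishes on `J^{F,[ℙ^{n/2}]} = (J^F : P)`** — by induction over the blocks: Thm. 1.3 (i) (`MacleanFormVanishes.join`)
and the recursion `blockSum_succ`, starting from the point case. (`d = e+1 ≥ 2` a unit in `K`.)
[cite: DuqueFrancoVillaflor2025Join, Example 5.1 ("`ℙ^{n/2} = J(Z_1,…,Z_{n/2+1})` … By item (i) of Theorem 1.3 its quadratic fundamental form also vanishes")] -/
theorem macleanFormVanishes_blockSum_fermatPolynomial (he : 1 ≤ e) (hdK : ((e + 1 : ℕ) : K) ≠ 0) :
    ∀ {m : ℕ} {ζ : Fin m → K} (_ : ∀ j, ζ j ^ (e + 1) = -1) {P : Fin m → MvPolynomial (Fin 2) K}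
      (_ : ∀ j, (P j).IsHomogeneous (e + 1 - 2))
      (_ : ∀ j, P j * pointForm (ζ j) = dfvNumerator (fermatPolynomial K 0 (e + 1)) (ζ j)),
      MacleanFormVanishes (blockSum fun _ : Fin m => fermatPolynomial K 0 (e + 1))
        (∏ j, rename (Prod.mk j) (P j))
  | 0, ζ, _, P, _, _ => by
    intro G H _ _ Q R _ _
    rw [macleanForm_eq_zero_of_isEmpty]
    exact Submodule.zero_mem _
  | m + 1, ζ, hζ, P, hPh, hP => by
    have ih := macleanFormVanishes_blockSum_fermatPolynomial he hdK (m := m) (fun j => hζ (Fin.castSucc j))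
      (fun j => hPh (Fin.castSucc j)) (fun j => hP (Fin.castSucc j))
    have hlast := macleanFormVanishes_fermatPolynomial_zero he hdK (hζ (Fin.last m)) (hPh (Fin.last m))
      (hP (Fin.last m))
    have hF0 : (fermatPolynomial K 0 (e + 1)).IsHomogeneous (e + 1) := isHomogeneous_fermatPolynomial 0 (e + 1)
    have hJ0 := isArtinianGorenstein_jacobianIdeal_fermatPolynomial_zero (K := K) he hdK
    have hJm : IsArtinianGorenstein
        (Ideal.span (Set.range fun z => pderiv z (blockSum fun _ : Fin m => fermatPolynomial K 0 (e + 1))))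
        (m * (2 * (e + 1 - 2))) :=
      isArtinianGorenstein_blockSumJacobian fun _ => hJ0
    have hjoin := MacleanFormVanishes.join (isHomogeneous_blockSum fun _ => hF0) hF0 (by omega) hJm hJ0 ih hlast
    have ht := hjoin.rename_equiv (blockEquiv m (Fin 2))
    have hb : blockSum (fun _ : Fin (m + 1) => fermatPolynomial K 0 (e + 1)) =
        rename (blockEquiv m (Fin 2)) (joinPoly (blockSum fun _ : Fin m => fermatPolynomial K 0 (e + 1))
          (fermatPolynomial K 0 (e + 1))) :=
      blockSum_succ _
    rw [hb, prod_rename_succ, map_mul]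
    rw [map_mul] at ht
    exact ht

/-! ### In the printed coordinates `x_{2j+i}` of `ℙ^{n+1}`, `n = 2k` -/

variable {k : ℕ}

/-- `∏_j P_j(x_{2j}, x_{2j+1})` is the relabelled `∏_j P_j(x_{(j,·)})`. [folklore] -/
private theorem prod_rename_pairIndexEquiv' (P : Fin (k + 1) → MvPolynomial (Fin 2) K) :
    ∏ j, rename (R := K) (fun i : Fin 2 => pairIndexEquiv k (j, i)) (P j) =
      rename (pairIndexEquiv k) (∏ j, rename (R := K) (Prod.mk j) (P j)) := by
  rw [map_prod]
  refine Finset.prod_congr rfl fun j _ => ?_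
  rw [rename_rename]
  rfl

/-- **`x_0^d + ⋯ + x_{n+1}^d` is the sum of the `n/2+1` binary Fermat forms `x_{2j}^d + x_{2j+1}^d`**, i.e. the
relabelled block sum ("the Fermat polynomial `x_0^d + ⋯ + x_{n+1}^d` can be written as a sum of `n/2+1` Fermat
polynomials in two variables"). [cite: DuqueFrancoVillaflor2025Join, Example 5.1] -/
theorem rename_pairIndexEquiv_blockSum_fermatPolynomial (k d : ℕ) :
    rename (pairIndexEquiv k) (blockSum fun _ : Fin (k + 1) => fermatPolynomial K 0 d) =
      fermatPolynomial K (2 * k) d := by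
  rw [blockSum, map_sum]
  unfold fermatPolynomial
  simp_rw [map_sum, map_pow, rename_X]
  rw [← (pairIndexEquiv k).sum_comp (fun l => (X l : MvPolynomial (Fin (2 * k + 1 + 1)) K) ^ d),
    Fintype.sum_prod_type]

/-- **Example 5.1: the quadratic fundamental form of the Hodge locus of the linear cycle
`ℙ^{n/2} = {x_0 − ζ_0x_1 = x_2 − ζ_1x_3 = ⋯ = x_n − ζ_{n/2}x_{n+1} = 0} ⊂ X^n_d = {x_0^d + ⋯ + x_{n+1}^d = 0}`
(`ζ_j^d = −1`, `n = 2k`) vanishes** — `q ≡ 0` on `J^{F,[ℙ^{n/2}]} = (J^F : ∏_j P_j(x_{2j},x_{2j+1}))`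
(`= ⟨x_0 − ζ_0x_1, x_1^{d−1}, …, x_n − ζ_{n/2}x_{n+1}, x_{n+1}^{d−1}⟩`, tree `jacobianIdeal_splitSumForm_colon_eq_span`)
modulo `J^F + ⟨P⟩`, for all pairs of elements and all lifts; `P_j` = DFV's polynomial of the point `(ζ_j:1)` of
`{x^d + y^d = 0}` (`∏_j P_j = P_{ℙ^{n/2}}` up to a unit, Thm. 1.1 / Example 5.1). (`d = e+1 ≥ 2` a unit in `K`.)
[cite: DuqueFrancoVillaflor2025Join, Example 5.1] -/
theorem macleanFormVanishes_fermatPolynomial_linearCycle (he : 1 ≤ e) (hdK : ((e + 1 : ℕ) : K) ≠ 0)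
    {ζ : Fin (k + 1) → K} (hζ : ∀ j, ζ j ^ (e + 1) = -1) {P : Fin (k + 1) → MvPolynomial (Fin 2) K}
    (hPh : ∀ j, (P j).IsHomogeneous (e + 1 - 2))
    (hP : ∀ j, P j * pointForm (ζ j) = dfvNumerator (fermatPolynomial K 0 (e + 1)) (ζ j)) :
    MacleanFormVanishes (fermatPolynomial K (2 * k) (e + 1))
      (∏ j, rename (fun i : Fin 2 => pairIndexEquiv k (j, i)) (P j)) := by
  have h := (macleanFormVanishes_blockSum_fermatPolynomial he hdK hζ hPh hP).rename_equiv (pairIndexEquiv k)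
  rw [rename_pairIndexEquiv_blockSum_fermatPolynomial, ← prod_rename_pairIndexEquiv'] at h
  exact h

end FermatBlocks

end Literature.AlgebraicGeometry.DuqueFrancoVillaflor2025

end
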